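import Literature.MathematicalPhysics.QuantumLattice.WilsonFeynmanHellmann
import Mathlib.Probability.Moments.MGFAnalytic
import HarnessLib

/-!
# Venture YMGap, track ROBUST-BALL (Y2) — tools: expectations under a bounded exponential tilt are `C¹` (Feynman–Hellmann) and
# real-analytic in the tilt parameter, on all of `ℝ`

HONEST FRAMING. WHAT THIS IS: a venture tool file (cell `pub-ymgap`, track Y2 ROBUST-BALL, seat rb-p1, theorems only, no door, no number; pure
probability) serving `LocalSourceResponse.lean` / `LocalSourceAnalytic.lean`.  For a probability measure `μ`, bounded measurable `H`, bounded
(a.e.-strongly) measurable `F`: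
* `hasDerivAt_integral_tilted_of_bounded` — `d/ds ∫ F d(μ.tilted (−s H)) |_{s=b} = −cov_{μ.tilted (−b H)}(F, H)` at EVERY real `b` (the
  Literature Feynman–Hellmann identity `hasDerivAt_integral_tilted_neg_eq_neg_covariance`, B. Simon 1993 §II.1, with the integrability
  interval of `e^{sH}` equal to `ℝ`);
* `integral_mul_exp_eq_mgf_sub` — `∫ F e^{tH} dμ = mgf_H((F + C)·μ)(t) − C · mgf_H(μ)(t)` (`C ≥ sup|F|`); hence
  `analyticAt_integral_tilted_mul_of_bounded` / `analyticAt_integral_tilted_of_bounded` — `t ↦ ∫ F d(μ.tilted (±t H))` is REAL-ANALYTIC at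
  every real `t` (quotient of moment generating functions, Mathlib `analyticAt_mgf`, positive denominator).
WHAT THIS IS NOT: pure bookkeeping; nothing about any model.
-/

noncomputable section

open MeasureTheory Function Finset Real ProbabilityTheory
open scoped NNReal ENNReal
open Literature.MathematicalPhysics.QuantumLattice

namespace Summit.Ventures.YMGap.RobustBall

/-! ### Feynman–Hellmann for a bounded tilt (the Literature identity, all real parameters) -/

section Tilt

variable {Ω : Type*} [MeasurableSpace Ω] {μ : Measure Ω} [IsProbabilityMeasure μ]

/-- **Feynman–Hellmann for a bounded tilt, every real parameter**: for bounded measurable `H` and bounded a.e.-strongly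
measurable `F`, `d/ds ∫ F d(μ.tilted (−s H)) = −cov_{μ.tilted (−b H)}(F, H)` at every `b ∈ ℝ` (the integrability interval
of `e^{sH}` is all of `ℝ`). -/
theorem hasDerivAt_integral_tilted_of_bounded {H F : Ω → ℝ} (hHm : Measurable H) {B : ℝ} (hHb : ∀ ω, |H ω| ≤ B)
    (hFm : AEStronglyMeasurable F μ) {C : ℝ} (hFb : ∀ ω, |F ω| ≤ C) (b : ℝ) :
    HasDerivAt (fun s : ℝ => ∫ ω, F ω ∂(μ.tilted fun ω => -s * H ω)) (-cov[F, H; μ.tilted fun ω => -b * H ω]) b := by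
  have hint : -b ∈ interior (integrableExpSet H μ) := by
    rw [integrableExpSet_eq_univ_of_abs_le hHm.aemeasurable (ae_of_all _ hHb), interior_univ]
    trivial
  exact hasDerivAt_integral_tilted_neg_eq_neg_covariance hint hFm
    (ae_of_all _ fun ω => by rw [Real.norm_eq_abs]; exact hFb ω)

end Tilt

/-! ### The abstract step: tilted expectations are quotients of moment generating functions -/

section Tilt

variable {Ω : Type*} [MeasurableSpace Ω] {μ : Measure Ω} [IsProbabilityMeasure μ]

/-- For bounded measurable `H`, the moment generating function of `H` under ANY finite measure is real-analytic at every
point (its integrability interval is all of `ℝ`). -/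
private theorem analyticAt_mgf_of_bounded {ν : Measure Ω} [IsFiniteMeasure ν] {H : Ω → ℝ} (hHm : Measurable H)
    {B : ℝ} (hHb : ∀ ω, |H ω| ≤ B) (t : ℝ) : AnalyticAt ℝ (mgf H ν) t := by
  refine analyticAt_mgf ?_
  rw [integrableExpSet_eq_univ_of_abs_le hHm.aemeasurable (ae_of_all _ hHb), interior_univ]
  trivial

/-- **The numerator is a difference of moment generating functions**: for measurable `F` with `|F| ≤ C`,
`∫ F e^{tH} dμ = mgf_H((F + C)·μ)(t) − C · mgf_H(μ)(t)`. -/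
theorem integral_mul_exp_eq_mgf_sub {H F : Ω → ℝ} (hHm : Measurable H) {B : ℝ} (hHb : ∀ ω, |H ω| ≤ B)
    (hFm : Measurable F) {C : ℝ} (hFb : ∀ ω, |F ω| ≤ C) (t : ℝ) :
    ∫ ω, F ω * exp (t * H ω) ∂μ =
      mgf H (μ.withDensity fun ω => ENNReal.ofReal (F ω + C)) t - C * mgf H μ t := by
  have hpos : ∀ ω, 0 ≤ F ω + C := fun ω => by linarith [(abs_le.1 (hFb ω)).1]
  have hexpb : ∀ ω, |exp (t * H ω)| ≤ exp (|t| * B) := fun ω => by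
    rw [abs_of_pos (exp_pos _)]
    refine exp_le_exp.2 ?_
    calc t * H ω ≤ |t * H ω| := le_abs_self _
      _ = |t| * |H ω| := abs_mul _ _
      _ ≤ |t| * B := mul_le_mul_of_nonneg_left (hHb ω) (abs_nonneg t)
  have hexpm : Measurable fun ω => exp (t * H ω) := (hHm.const_mul t).exp
  have hint_exp : Integrable (fun ω => exp (t * H ω)) μ :=
    Integrable.of_bound hexpm.aestronglyMeasurable (exp (|t| * B))
      (ae_of_all _ fun ω => by rw [Real.norm_eq_abs]; exact hexpb ω)
  have hint_FC : Integrable (fun ω => (F ω + C) * exp (t * H ω)) μ :=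
    Integrable.of_bound ((hFm.add_const C).mul hexpm).aestronglyMeasurable ((C + C) * exp (|t| * B))
      (ae_of_all _ fun ω => by
        rw [Real.norm_eq_abs, abs_mul, abs_of_nonneg (hpos ω)]
        refine mul_le_mul ?_ (hexpb ω) (abs_nonneg _) (by linarith [(abs_nonneg (F ω)).trans (hFb ω)])
        linarith [(abs_le.1 (hFb ω)).2])
  -- the `mgf` of the weighted measure
  have hmgf : mgf H (μ.withDensity fun ω => ENNReal.ofReal (F ω + C)) t = ∫ ω, (F ω + C) * exp (t * H ω) ∂μ := by
    simp only [mgf]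
    rw [integral_withDensity_eq_integral_toReal_smul (hFm.add_const C).ennreal_ofReal
      (Filter.Eventually.of_forall fun _ => ENNReal.ofReal_lt_top)]
    refine integral_congr_ae (ae_of_all _ fun ω => ?_)
    simp only [smul_eq_mul, ENNReal.toReal_ofReal (hpos ω)]
  rw [hmgf]
  simp only [mgf]
  rw [← integral_const_mul, ← integral_sub hint_FC (hint_exp.const_mul C)]
  refine integral_congr_ae (ae_of_all _ fun ω => ?_)
  ring

/-- **TILTED EXPECTATIONS OF BOUNDED OBSERVABLES ARE REAL-ANALYTIC IN THE TILT PARAMETER, ON ALL OF `ℝ`**: for bounded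
measurable `H` and `F`, `t ↦ ∫ F d(μ.tilted (t H))` is `AnalyticAt ℝ` at every `t`. -/
theorem analyticAt_integral_tilted_mul_of_bounded {H F : Ω → ℝ} (hHm : Measurable H) {B : ℝ} (hHb : ∀ ω, |H ω| ≤ B)
    (hFm : Measurable F) {C : ℝ} (hFb : ∀ ω, |F ω| ≤ C) (t₀ : ℝ) :
    AnalyticAt ℝ (fun t : ℝ => ∫ ω, F ω ∂(μ.tilted fun ω => t * H ω)) t₀ := by
  have hpos : ∀ ω, 0 ≤ F ω + C := fun ω => by linarith [(abs_le.1 (hFb ω)).1]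
  -- the weighted measure is finite
  have hfinI : HasFiniteIntegral (fun ω => F ω + C) μ :=
    (Integrable.of_bound (hFm.add_const C).aestronglyMeasurable (C + C) (ae_of_all _ fun ω => by
      rw [Real.norm_eq_abs, abs_of_nonneg (hpos ω)]; linarith [(abs_le.1 (hFb ω)).2])).hasFiniteIntegral
  haveI : IsFiniteMeasure (μ.withDensity fun ω => ENNReal.ofReal (F ω + C)) := isFiniteMeasure_withDensity_ofReal hfinI
  -- the quotient formula
  have hfun : (fun t : ℝ => ∫ ω, F ω ∂(μ.tilted fun ω => t * H ω)) = fun t =>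
      (mgf H (μ.withDensity fun ω => ENNReal.ofReal (F ω + C)) t - C * mgf H μ t) / mgf H μ t := by
    funext t
    rw [← integral_mul_exp_eq_mgf_sub hHm hHb hFm hFb t]
    exact integral_tilted_eq_integral_mul_exp_div_mgf F t
  rw [hfun]
  have hZ : mgf H μ t₀ ≠ 0 := by
    refine (mgf_pos' (IsProbabilityMeasure.ne_zero μ) ?_).ne'
    refine Integrable.of_bound ((hHm.const_mul t₀).exp).aestronglyMeasurable (exp (|t₀| * B))
      (ae_of_all _ fun ω => ?_)
    rw [Real.norm_eq_abs, abs_of_pos (exp_pos _)]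
    refine exp_le_exp.2 ?_
    calc t₀ * H ω ≤ |t₀ * H ω| := le_abs_self _
      _ = |t₀| * |H ω| := abs_mul _ _
      _ ≤ |t₀| * B := mul_le_mul_of_nonneg_left (hHb ω) (abs_nonneg t₀)
  exact ((analyticAt_mgf_of_bounded hHm hHb t₀).sub
    (analyticAt_const.mul (analyticAt_mgf_of_bounded hHm hHb t₀))).fun_div (analyticAt_mgf_of_bounded hHm hHb t₀) hZ

/-- The Gibbs convention: `t ↦ ∫ F d(μ.tilted (−t H))` is real-analytic at every `t`. -/
theorem analyticAt_integral_tilted_of_bounded {H F : Ω → ℝ} (hHm : Measurable H) {B : ℝ} (hHb : ∀ ω, |H ω| ≤ B)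
    (hFm : Measurable F) {C : ℝ} (hFb : ∀ ω, |F ω| ≤ C) (t₀ : ℝ) :
    AnalyticAt ℝ (fun t : ℝ => ∫ ω, F ω ∂(μ.tilted fun ω => -t * H ω)) t₀ := by
  have hfun : (fun t : ℝ => ∫ ω, F ω ∂(μ.tilted fun ω => -t * H ω)) =
      fun t : ℝ => ∫ ω, F ω ∂(μ.tilted fun ω => t * (-H ω)) := by
    funext t
    congr 2
    funext ω
    ring
  rw [hfun]
  exact analyticAt_integral_tilted_mul_of_bounded (H := fun ω => -H ω) hHm.neg
    (fun ω => by simp only [abs_neg]; exact hHb ω) hFm hFb t₀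

end Tilt

end Summit.Ventures.YMGap.RobustBall

end
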